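import Mathlib
import Summits.KontsevichZagierPeriods.Zeta5Search.Profile2aCellsA
import Summits.KontsevichZagierPeriods.Zeta5Search.Profile2aCellsB
import Summits.KontsevichZagierPeriods.Zeta5Search.Profile1aCellsA
import Summits.KontsevichZagierPeriods.Zeta5Search.Profile1aCellsB
import Summits.KontsevichZagierPeriods.Zeta5Search.DenomLaw.Profile15aPath
import Summits.KontsevichZagierPeriods.Zeta5Search.DenomLaw.PathWeightProfile
import Summits.KontsevichZagierPeriods.Zeta5Search.DenomLaw.LawZL5CoverKit
import Summits.KontsevichZagierPeriods.Zeta5Search.FlagRayDominance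
import Summits.KontsevichZagierPeriods.Zeta5Search.TopFamilyFPCasLB
import Summits.KontsevichZagierPeriods.Zeta5Search.DenomLaw.Profile11PathA
import Summits.KontsevichZagierPeriods.Zeta5Search.DenomLaw.Profile10PathC
import HarnessLib

/-!

Split (gen 23) of gen 22's farm-checked `ProfileLe4Path` draft (569 lines > the 400-line rule) into `ProfileLe4PathA` (4a, 3b) and `ProfileLe4PathB` (2a, 1a);
the theorems and their names are unchanged.
# ζ(5) search — the `N_p ≤ 4` PROFILES 4a, 3b, 2a, 1a of the first period for EVERY sorted parameter vector: PATH accounting at every depth (DENOM-LAW D1, prover-d1 gen 22)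

Cell `pub-zeta5` (HONEST FRAMING: systematic search; no irrationality claim unless certified), TRACK «DENOM-LAW» D1 prover seat (denom-prover-d1
gen 22, `HOME/denom-law/prover-d1/ATTEMPT-22.md` §6).  The four a = 7 profiles with at most four long pair blocks on which THEOREM LB alone reaches the node
(`d < 2p` on each; THEOREM LB for every `d` via gen 22's `casLB_ge_of_cover_le0` at `⌊d/p⌋ = 0`, THEOREM LB with the single-pole row at `p ≤ d`):
4a long blocks exactly `(3,7),(4,7),(5,7),(6,7)` (`C⋆ ≤ 7`, new finite check; `(A, B) = (−2,0)` / `(−2,1)`; node `−2 / −1`); 3b long blocks exactly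
`(4,7),(5,7),(6,7)` (`C⋆ ≤ 7`; `(−1,0)` / `(−1,1)`; node `−1 / 0`); 2a long blocks exactly `(5,7),(6,7)` (`C⋆ ≤ 7`; `(0,0)` / LB♯ `0 + 1`; node `0 / 1`);
1a long block exactly `(6,7)` (`C⋆ ≤ 6`; `(0,0)` / LB♯ `0 + 1`; node `0 / 1`) — at `p ≤ d` on 2a and 1a the node is POSITIVE (`1`), so the single-pole row is taken through
gen 19's `casoratian_bound_pal` (gen 22's `cover_LBP_j`, `DenomLaw/Profile10PathC`), which closes THEOREM LB's `casLB = 0` escape by the Casoratian's non-vanishing.  Covers `FullProfile.cover4a/3b/2a/1a_ev/od` (`Profile{4a,3b,2a,1a}Cells{A,B}`,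
machine-generated; every check `decide`).  Results: `pathAccounting_profileNx` (every `j`) and **`pathAccountingFirstPeriod_profileNx`** (the node's binders
VERBATIM plus `p ≤ b₇` and the profile inequalities; no depth hypothesis), Nx ∈ {4a, 3b, 2a, 1a}.  The two remaining `N_p ≤ 4` profiles realised at p ≤ 13 (4b: long
`(4,7),(5,6),(5,7),(6,7)`; 3a: long `(5,6),(5,7),(6,7)`) are NOT treated here (no common landed law across their instances: they want the VG-type laws).
Census beside the proof (gen 22, exhaustive a = 7 at p = 7, 11): 4a 2,114 · 3b 2,208 · 2a 1,944 · 1a 3,385 instances (untreated: 4b 1,321 · 3a 4,910); every instance of the four treated profiles reached by THEOREM LB; 0 open at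
p ≤ 13 (kit j285126).  MODEL/structure-side valuation bookkeeping of the cell's own rationals; nothing about ζ(5); no γ; records in print UNMOVED.
-/

open Finset

namespace Summit.KontsevichZagierPeriods.Zeta5Search.FullProfile

open Summit.KontsevichZagierPeriods.Zeta5Search.ClusterValuation
open Summit.KontsevichZagierPeriods.Zeta5Search.CasoratianValuation (InPolytope shift casoratian pairFloors refund)
open Summit.KontsevichZagierPeriods.Zeta5Search.WedgeDictionary (dOf)
open Summit.KontsevichZagierPeriods.Zeta5Search.ClassTypeCover
open Summit.KontsevichZagierPeriods.Zeta5Search.DenomLaw (cStar FirstPeriod Sorted7 zeroClasses_of_cover zeroBound_of_classes zeroPointBound_of_classes cover_A3K cover_A4 cover_ZA rowsPal_of_cover)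
open Summit.KontsevichZagierPeriods.Zeta5Search.DenomLaw.FirstPeriodKit (cStar_le_eleven sorted7_chain firstPeriod_pair pairFloors_expand)
open Summit.KontsevichZagierPeriods.Zeta5Search.ZeroWindows (ZeroWindowClasses)
open Summit.KontsevichZagierPeriods.Zeta5Search.TopFamFP (cover_J_j)
open Summit.KontsevichZagierPeriods.Zeta5Search.StairFLAG (cover_B_j)
open Summit.KontsevichZagierPeriods.Zeta5Search.SortedProfile

/-! ## Path-weight bounds on 2a, 1a -/

/-- **`C⋆ ≤ 7` on 2a**. -/
theorem cStar_le_seven_2a {b : ℕ → ℤ} {p : ℕ} (hs : Sorted7 b) (hQ : b 0 < (p : ℤ) + b 5 + b 6) (hQ47 : b 0 < (p : ℤ) + b 4 + b 7) : cStar b p ≤ 7 := by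
  obtain ⟨h21, h32, h43, h54, h65, h76⟩ := sorted7_chain hs
  refine DenomLaw.FirstPeriodKit.cStar_le_of_profile (fun _ => True)
    (fun i k => ¬ (((i.val ≤ 5 ∧ k.val ≤ 5) ∨ (i.val ≤ 3 ∧ k.val = 6) ∨ (k.val ≤ 3 ∧ i.val = 6)) ∧ i.val ≠ k.val)) 7
    (fun _ _ => trivial) ?_ (by decide +kernel)
  intro i k hik h
  obtain ⟨h, hne⟩ := h
  have := i.isLt; have := k.isLt
  exfalso
  rcases h with ⟨hi, hk⟩ | ⟨hi, hk⟩ | ⟨hk, hi⟩ <;> interval_cases hv : i.val <;> interval_cases hw : k.val <;>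
    simp only [Nat.reduceAdd] at hik <;> omega


/-- **`C⋆ ≤ 6` on 1a**. -/
theorem cStar_le_six_1a {b : ℕ → ℤ} {p : ℕ} (hs : Sorted7 b) (hQ : b 0 < (p : ℤ) + b 5 + b 6) (hQ57 : b 0 < (p : ℤ) + b 5 + b 7) : cStar b p ≤ 6 := by
  obtain ⟨h21, h32, h43, h54, h65, h76⟩ := sorted7_chain hs
  refine DenomLaw.FirstPeriodKit.cStar_le_of_profile (fun _ => True)
    (fun i k => ¬ (((i.val ≤ 5 ∧ k.val ≤ 5) ∨ (i.val ≤ 4 ∧ k.val = 6) ∨ (k.val ≤ 4 ∧ i.val = 6)) ∧ i.val ≠ k.val)) 6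
    (fun _ _ => trivial) ?_ (by decide +kernel)
  intro i k hik h
  obtain ⟨h, hne⟩ := h
  have := i.isLt; have := k.isLt
  exfalso
  rcases h with ⟨hi, hk⟩ | ⟨hi, hk⟩ | ⟨hk, hi⟩ <;> interval_cases hv : i.val <;> interval_cases hw : k.val <;>
    simp only [Nat.reduceAdd] at hik <;> omega


/-! ## The `N_p = 2` profile with short blocks `every (i,k) except (5,7),(6,7)` -/

section P2A

variable {b : ℕ → ℤ} {j p : ℕ}

/-- **`N_p = 2`** on this profile: the pair digits of the nineteen short blocks are `0`, the other two are `1`. -/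
theorem pairFloors_eq_2a (hb : InPolytope b) (hs : Sorted7 b) (hp : 0 < p) (hQ : b 0 < (p : ℤ) + b 5 + b 6) (hQ47 : b 0 < (p : ℤ) + b 4 + b 7) (hQ57 : (p : ℤ) + b 5 + b 7 ≤ b 0) (hfp : FirstPeriod b p) : pairFloors b p = 2 := by
  obtain ⟨h21, h32, h43, h54, h65, h76⟩ := sorted7_chain hs
  obtain ⟨h0, hb1, hb2, hb3, hb4, hb5, hb6, hb7, hc1⟩ := box hb
  have hp0 : (0 : ℤ) < p := by exact_mod_cast hp
  have one : ∀ z : ℤ, (p : ℤ) ≤ z → z ≤ 2 * (p : ℤ) - 1 → z / (p : ℤ) = 1 := fun z h1 h2 => by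
    rw [Int.ediv_eq_iff_of_pos hp0]; constructor <;> linarith
  have z12 : (b 0 - b 1 - b 2) / (p : ℤ) = 0 := Int.ediv_eq_zero_of_lt (by linarith) (by linarith)
  have z13 : (b 0 - b 1 - b 3) / (p : ℤ) = 0 := Int.ediv_eq_zero_of_lt (by linarith) (by linarith)
  have z14 : (b 0 - b 1 - b 4) / (p : ℤ) = 0 := Int.ediv_eq_zero_of_lt (by linarith) (by linarith)
  have z15 : (b 0 - b 1 - b 5) / (p : ℤ) = 0 := Int.ediv_eq_zero_of_lt (by linarith) (by linarith)
  have z16 : (b 0 - b 1 - b 6) / (p : ℤ) = 0 := Int.ediv_eq_zero_of_lt (by linarith) (by linarith)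
  have z17 : (b 0 - b 1 - b 7) / (p : ℤ) = 0 := Int.ediv_eq_zero_of_lt (by linarith) (by linarith)
  have z23 : (b 0 - b 2 - b 3) / (p : ℤ) = 0 := Int.ediv_eq_zero_of_lt (by linarith) (by linarith)
  have z24 : (b 0 - b 2 - b 4) / (p : ℤ) = 0 := Int.ediv_eq_zero_of_lt (by linarith) (by linarith)
  have z25 : (b 0 - b 2 - b 5) / (p : ℤ) = 0 := Int.ediv_eq_zero_of_lt (by linarith) (by linarith)
  have z26 : (b 0 - b 2 - b 6) / (p : ℤ) = 0 := Int.ediv_eq_zero_of_lt (by linarith) (by linarith)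
  have z27 : (b 0 - b 2 - b 7) / (p : ℤ) = 0 := Int.ediv_eq_zero_of_lt (by linarith) (by linarith)
  have z34 : (b 0 - b 3 - b 4) / (p : ℤ) = 0 := Int.ediv_eq_zero_of_lt (by linarith) (by linarith)
  have z35 : (b 0 - b 3 - b 5) / (p : ℤ) = 0 := Int.ediv_eq_zero_of_lt (by linarith) (by linarith)
  have z36 : (b 0 - b 3 - b 6) / (p : ℤ) = 0 := Int.ediv_eq_zero_of_lt (by linarith) (by linarith)
  have z37 : (b 0 - b 3 - b 7) / (p : ℤ) = 0 := Int.ediv_eq_zero_of_lt (by linarith) (by linarith)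
  have z45 : (b 0 - b 4 - b 5) / (p : ℤ) = 0 := Int.ediv_eq_zero_of_lt (by linarith) (by linarith)
  have z46 : (b 0 - b 4 - b 6) / (p : ℤ) = 0 := Int.ediv_eq_zero_of_lt (by linarith) (by linarith)
  have z47 : (b 0 - b 4 - b 7) / (p : ℤ) = 0 := Int.ediv_eq_zero_of_lt (by linarith) (by linarith)
  have z56 : (b 0 - b 5 - b 6) / (p : ℤ) = 0 := Int.ediv_eq_zero_of_lt (by linarith) (by linarith)
  have U := fun (i k : ℕ) (hi : i < 7) (hk : k < 7) (hik : i < k) => firstPeriod_pair hfp hi hk hik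
  rw [pairFloors_expand, z12, z13, z14, z15, z16, z17, z23, z24, z25, z26, z27, z34, z35, z36, z37, z45, z46, z47, z56,
    one _ (by linarith) (U 4 6 (by norm_num) (by norm_num) (by norm_num)),
    one _ (by linarith) (U 5 6 (by norm_num) (by norm_num) (by norm_num))]
  norm_num

/-- **THEOREM LB on this profile, general `b`, any depth**: `v_p(Cas_j(b)) ≥ 0` (`(A, B) = (0, 0)`, `B ≤ 0`; gen 22's `casLB_ge_of_cover_le0`). -/
theorem cas_ge2a_zero (hb : InPolytope b) (hs : Sorted7 b) (hbj : InPolytope (shift b j)) (hj1 : 1 ≤ j) (hj7 : j ≤ 7)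
    (hprime : p.Prime) (hp5 : 5 ≤ p) (hwin : (b 0 + 2 : ℤ) < (p : ℤ) ^ 2) (hP : (p : ℤ) ≤ b 7) (hQ : b 0 < (p : ℤ) + b 5 + b 6) (hQ47 : b 0 < (p : ℤ) + b 4 + b 7) (hQ57 : (p : ℤ) + b 5 + b 7 ≤ b 0)
    (hF1 : b 1 < 2 * (p : ℤ)) (hF2 : b 0 < 2 * (p : ℤ) + b 6 + b 7) (hcas : casoratian b j ≠ 0) : (0 : ℤ) ≤ padicValRat p (casoratian b j) := by
  haveI : Fact p.Prime := ⟨hprime⟩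
  have hp2 : p % 2 = 1 := Nat.odd_iff.1 (hprime.odd_of_ne_two (by omega))
  have hv := casoratianClassBound_holds b j p hb hj1 hj7 hbj hprime hp5 hwin hcas
  rcases Int.emod_two_eq_zero_or_one (b 0) with hr | hr
  · rcases casLB_ge_of_cover_le0 (cover2a_ev hb hs hP hQ hQ47 hQ57 hF1 hF2 hp5 hp2 hr) (A := 0) (B := 0) (by rw [oddFlag_false hr]; decide) (by norm_num) with h0 | h
    · rw [h0] at hv; linarith
    · linarith
  · rcases casLB_ge_of_cover_le0 (cover2a_od hb hs hP hQ hQ47 hQ57 hF1 hF2 hp5 hp2 hr) (A := 0) (B := 0) (by rw [oddFlag_true hr]; decide) (by norm_num) with h0 | h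
    · rw [h0] at hv; linarith
    · linarith

/-- **THEOREM LB♯ (palindromic rows) on this profile at `p ≤ d`, general `b`**: `v_p(Cas_j(b)) ≥ 1 = VB + row` (`VB = 0`, row `1`; gen 19's
`casoratian_bound_pal` through gen 22's `cover_LBP_j`).  Used instead of `casLB_ge_of_cover` because the bound is POSITIVE: the latter's escape clause
`casLB = 0` (no pole class at all) is closed inside `casoratian_bound_pal` by the non-vanishing of the Casoratian. -/
theorem cas_ge2a_pos1 (hb : InPolytope b) (hs : Sorted7 b) (hbj : InPolytope (shift b j)) (hj1 : 1 ≤ j) (hj7 : j ≤ 7)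
    (hprime : p.Prime) (hp5 : 5 ≤ p) (hwin : (b 0 + 2 : ℤ) < (p : ℤ) ^ 2) (hP : (p : ℤ) ≤ b 7) (hQ : b 0 < (p : ℤ) + b 5 + b 6) (hQ47 : b 0 < (p : ℤ) + b 4 + b 7) (hQ57 : (p : ℤ) + b 5 + b 7 ≤ b 0)
    (hF1 : b 1 < 2 * (p : ℤ)) (hF2 : b 0 < 2 * (p : ℤ) + b 6 + b 7) (hpd : (p : ℤ) ≤ dOf b) (hcas : casoratian b j ≠ 0) : (1 : ℤ) ≤ padicValRat p (casoratian b j) := by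
  haveI : Fact p.Prime := ⟨hprime⟩
  have hp2 : p % 2 = 1 := Nat.odd_iff.1 (hprime.odd_of_ne_two (by omega))
  obtain ⟨h21, h32, h43, h54, h65, h76⟩ := sorted7_chain hs
  obtain ⟨h0, hb1, hb2, hb3, hb4, hb5, hb6, hb7, hc1⟩ := box hb
  have hpb : (p : ℤ) ≤ b 0 := by linarith
  rcases Int.emod_two_eq_zero_or_one (b 0) with hr | hr
  · exact cover_LBP_j hb hj1 hj7 hbj hprime hp5 hpb hwin (cover2a_ev hb hs hP hQ hQ47 hQ57 hF1 hF2 hp5 hp2 hr) (v := 0) (B₀ := -20) (r := 1)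
      (by rw [oddFlag_false hr]; decide) (by norm_num) (by rw [oddFlag_false hr]; decide) (fun h => absurd hpd (not_le.2 h)) hcas
  · exact cover_LBP_j hb hj1 hj7 hbj hprime hp5 hpb hwin (cover2a_od hb hs hP hQ hQ47 hQ57 hF1 hF2 hp5 hp2 hr) (v := 0) (B₀ := -20) (r := 1)
      (by rw [oddFlag_true hr]; decide) (by norm_num) (by rw [oddFlag_true hr]; decide) (fun h => absurd hpd (not_le.2 h)) hcas

/-- On this profile `d(b) < 2p`. -/
theorem d_lt_two2a (hs : Sorted7 b) (hP : (p : ℤ) ≤ b 7) (_hQ : b 0 < (p : ℤ) + b 5 + b 6) (_hQ47 : b 0 < (p : ℤ) + b 4 + b 7) (_hQ57 : (p : ℤ) + b 5 + b 7 ≤ b 0) : dOf b < 2 * (p : ℤ) := by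
  obtain ⟨h21, h32, h43, h54, h65, h76⟩ := sorted7_chain hs
  rw [DecompositionWholeCone.dOf_expand]; linarith

/-- **`PathAccountingFirstPeriod`'s conclusion on this `N_p = 2` profile (short blocks `every (i,k) except (5,7),(6,7)`), EVERY sorted `b`, every direction `j`, every depth**
(`C⋆ ≤ 7`; `d < 2p`; the node asks `0` at `⌊d/p⌋ = 0` and `1` at `⌊d/p⌋ = 1`). -/
theorem pathAccounting_profile2a (b : ℕ → ℤ) (j p : ℕ) (hb : InPolytope b) (hs : Sorted7 b) (hbj : InPolytope (shift b j))
    (hj1 : 1 ≤ j) (hj7 : j ≤ 7) (hprime : p.Prime) (hp5 : 5 ≤ p) (hwin : (b 0 + 2 : ℤ) < (p : ℤ) ^ 2) (hfp : FirstPeriod b p)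
    (hP : (p : ℤ) ≤ b 7) (hQ : b 0 < (p : ℤ) + b 5 + b 6) (hQ47 : b 0 < (p : ℤ) + b 4 + b 7) (hQ57 : (p : ℤ) + b 5 + b 7 ≤ b 0)
    (hcas : casoratian b j ≠ 0) :
    dOf b / (p : ℤ) - pairFloors b p - min (if 2 ≤ dOf b / (p : ℤ) then (1 : ℤ) else 0) (5 - (cStar b p : ℤ))
      ≤ padicValRat p (casoratian b j) := by
  obtain ⟨hF1, hF2⟩ := fp_bounds hfp
  have hp0 : (0 : ℤ) < p := by exact_mod_cast hprime.pos
  rw [pairFloors_eq_2a hb hs hprime.pos hQ hQ47 hQ57 hfp]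
  have hC7 : (cStar b p : ℤ) ≤ 7 := by exact_mod_cast cStar_le_seven_2a hs hQ hQ47
  have hfd : dOf b / (p : ℤ) < 2 := by rw [Int.ediv_lt_iff_lt_mul hp0]; linarith [d_lt_two2a hs hP hQ hQ47 hQ57]
  rw [if_neg (by omega)]
  have hmin : -2 ≤ min (0 : ℤ) (5 - (cStar b p : ℤ)) := le_min (by norm_num) (by linarith)
  by_cases h1 : (p : ℤ) ≤ dOf b
  · linarith [cas_ge2a_pos1 hb hs hbj hj1 hj7 hprime hp5 hwin hP hQ hQ47 hQ57 hF1 hF2 h1 hcas]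
  · push Not at h1
    obtain ⟨h21, h32, h43, h54, h65, h76⟩ := sorted7_chain hs
    have hsum := hb.2.2
    simp only [Finset.sum_range_succ, Finset.sum_range_zero, zero_add, Nat.reduceAdd] at hsum
    have hd0 : 0 ≤ dOf b := by rw [DecompositionWholeCone.dOf_expand]; linarith
    have hfd0 : dOf b / (p : ℤ) = 0 := Int.ediv_eq_zero_of_lt hd0 h1
    rw [hfd0]
    linarith [cas_ge2a_zero hb hs hbj hj1 hj7 hprime hp5 hwin hP hQ hQ47 hQ57 hF1 hF2 hcas]

/-- **THE NODE ON THIS `N_p = 2` PROFILE, EVERY SORTED `b`, EVERY DEPTH: `PathAccountingFirstPeriod` with its binders VERBATIM plus `p ≤ b₇` and the profile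
inequalities.** -/
theorem pathAccountingFirstPeriod_profile2a :
    ∀ (b : ℕ → ℤ) (p : ℕ), InPolytope b → Sorted7 b → InPolytope (shift b 7) →
      p.Prime → 5 ≤ p → (b 0 + 2 : ℤ) < (p : ℤ) ^ 2 → FirstPeriod b p →
      (p : ℤ) ≤ b 7 → b 0 < (p : ℤ) + b 5 + b 6 → b 0 < (p : ℤ) + b 4 + b 7 → (p : ℤ) + b 5 + b 7 ≤ b 0 → casoratian b 7 ≠ 0 →
        dOf b / (p : ℤ) - pairFloors b p - min (if 2 ≤ dOf b / (p : ℤ) then (1 : ℤ) else 0) (5 - (cStar b p : ℤ))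
          ≤ padicValRat p (casoratian b 7) :=
  fun b p hb hs hb7 hprime hp5 hwin hfp hP hQ hQ47 hQ57 hcas =>
    pathAccounting_profile2a b 7 p hb hs hb7 (by norm_num) (by norm_num) hprime hp5 hwin hfp hP hQ hQ47 hQ57 hcas

end P2A

/-! ## The `N_p = 1` profile with short blocks `every (i,k) except (6,7)` -/

section P1A

variable {b : ℕ → ℤ} {j p : ℕ}

/-- **`N_p = 1`** on this profile: the pair digits of the twenty short blocks are `0`, the remaining one is `1`. -/
theorem pairFloors_eq_1a (hb : InPolytope b) (hs : Sorted7 b) (hp : 0 < p) (hQ : b 0 < (p : ℤ) + b 5 + b 6) (hQ57 : b 0 < (p : ℤ) + b 5 + b 7) (hQ67 : (p : ℤ) + b 6 + b 7 ≤ b 0) (hfp : FirstPeriod b p) : pairFloors b p = 1 := by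
  obtain ⟨h21, h32, h43, h54, h65, h76⟩ := sorted7_chain hs
  obtain ⟨h0, hb1, hb2, hb3, hb4, hb5, hb6, hb7, hc1⟩ := box hb
  have hp0 : (0 : ℤ) < p := by exact_mod_cast hp
  have one : ∀ z : ℤ, (p : ℤ) ≤ z → z ≤ 2 * (p : ℤ) - 1 → z / (p : ℤ) = 1 := fun z h1 h2 => by
    rw [Int.ediv_eq_iff_of_pos hp0]; constructor <;> linarith
  have z12 : (b 0 - b 1 - b 2) / (p : ℤ) = 0 := Int.ediv_eq_zero_of_lt (by linarith) (by linarith)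
  have z13 : (b 0 - b 1 - b 3) / (p : ℤ) = 0 := Int.ediv_eq_zero_of_lt (by linarith) (by linarith)
  have z14 : (b 0 - b 1 - b 4) / (p : ℤ) = 0 := Int.ediv_eq_zero_of_lt (by linarith) (by linarith)
  have z15 : (b 0 - b 1 - b 5) / (p : ℤ) = 0 := Int.ediv_eq_zero_of_lt (by linarith) (by linarith)
  have z16 : (b 0 - b 1 - b 6) / (p : ℤ) = 0 := Int.ediv_eq_zero_of_lt (by linarith) (by linarith)
  have z17 : (b 0 - b 1 - b 7) / (p : ℤ) = 0 := Int.ediv_eq_zero_of_lt (by linarith) (by linarith)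
  have z23 : (b 0 - b 2 - b 3) / (p : ℤ) = 0 := Int.ediv_eq_zero_of_lt (by linarith) (by linarith)
  have z24 : (b 0 - b 2 - b 4) / (p : ℤ) = 0 := Int.ediv_eq_zero_of_lt (by linarith) (by linarith)
  have z25 : (b 0 - b 2 - b 5) / (p : ℤ) = 0 := Int.ediv_eq_zero_of_lt (by linarith) (by linarith)
  have z26 : (b 0 - b 2 - b 6) / (p : ℤ) = 0 := Int.ediv_eq_zero_of_lt (by linarith) (by linarith)
  have z27 : (b 0 - b 2 - b 7) / (p : ℤ) = 0 := Int.ediv_eq_zero_of_lt (by linarith) (by linarith)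
  have z34 : (b 0 - b 3 - b 4) / (p : ℤ) = 0 := Int.ediv_eq_zero_of_lt (by linarith) (by linarith)
  have z35 : (b 0 - b 3 - b 5) / (p : ℤ) = 0 := Int.ediv_eq_zero_of_lt (by linarith) (by linarith)
  have z36 : (b 0 - b 3 - b 6) / (p : ℤ) = 0 := Int.ediv_eq_zero_of_lt (by linarith) (by linarith)
  have z37 : (b 0 - b 3 - b 7) / (p : ℤ) = 0 := Int.ediv_eq_zero_of_lt (by linarith) (by linarith)
  have z45 : (b 0 - b 4 - b 5) / (p : ℤ) = 0 := Int.ediv_eq_zero_of_lt (by linarith) (by linarith)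
  have z46 : (b 0 - b 4 - b 6) / (p : ℤ) = 0 := Int.ediv_eq_zero_of_lt (by linarith) (by linarith)
  have z47 : (b 0 - b 4 - b 7) / (p : ℤ) = 0 := Int.ediv_eq_zero_of_lt (by linarith) (by linarith)
  have z56 : (b 0 - b 5 - b 6) / (p : ℤ) = 0 := Int.ediv_eq_zero_of_lt (by linarith) (by linarith)
  have z57 : (b 0 - b 5 - b 7) / (p : ℤ) = 0 := Int.ediv_eq_zero_of_lt (by linarith) (by linarith)
  have U := fun (i k : ℕ) (hi : i < 7) (hk : k < 7) (hik : i < k) => firstPeriod_pair hfp hi hk hik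
  rw [pairFloors_expand, z12, z13, z14, z15, z16, z17, z23, z24, z25, z26, z27, z34, z35, z36, z37, z45, z46, z47, z56, z57,
    one _ (by linarith) (U 5 6 (by norm_num) (by norm_num) (by norm_num))]
  norm_num

/-- **THEOREM LB on this profile, general `b`, any depth**: `v_p(Cas_j(b)) ≥ 0` (`(A, B) = (0, 0)`, `B ≤ 0`; gen 22's `casLB_ge_of_cover_le0`). -/
theorem cas_ge1a_zero (hb : InPolytope b) (hs : Sorted7 b) (hbj : InPolytope (shift b j)) (hj1 : 1 ≤ j) (hj7 : j ≤ 7)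
    (hprime : p.Prime) (hp5 : 5 ≤ p) (hwin : (b 0 + 2 : ℤ) < (p : ℤ) ^ 2) (hP : (p : ℤ) ≤ b 7) (hQ : b 0 < (p : ℤ) + b 5 + b 6) (hQ57 : b 0 < (p : ℤ) + b 5 + b 7) (hQ67 : (p : ℤ) + b 6 + b 7 ≤ b 0)
    (hF1 : b 1 < 2 * (p : ℤ)) (hF2 : b 0 < 2 * (p : ℤ) + b 6 + b 7) (hcas : casoratian b j ≠ 0) : (0 : ℤ) ≤ padicValRat p (casoratian b j) := by
  haveI : Fact p.Prime := ⟨hprime⟩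
  have hp2 : p % 2 = 1 := Nat.odd_iff.1 (hprime.odd_of_ne_two (by omega))
  have hv := casoratianClassBound_holds b j p hb hj1 hj7 hbj hprime hp5 hwin hcas
  rcases Int.emod_two_eq_zero_or_one (b 0) with hr | hr
  · rcases casLB_ge_of_cover_le0 (cover1a_ev hb hs hP hQ hQ57 hQ67 hF1 hF2 hp5 hp2 hr) (A := 0) (B := 0) (by rw [oddFlag_false hr]; decide) (by norm_num) with h0 | h
    · rw [h0] at hv; linarith
    · linarith
  · rcases casLB_ge_of_cover_le0 (cover1a_od hb hs hP hQ hQ57 hQ67 hF1 hF2 hp5 hp2 hr) (A := 0) (B := 0) (by rw [oddFlag_true hr]; decide) (by norm_num) with h0 | h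
    · rw [h0] at hv; linarith
    · linarith

/-- **THEOREM LB♯ (palindromic rows) on this profile at `p ≤ d`, general `b`**: `v_p(Cas_j(b)) ≥ 1 = VB + row` (`VB = 0`, row `1`; gen 19's
`casoratian_bound_pal` through gen 22's `cover_LBP_j`).  Used instead of `casLB_ge_of_cover` because the bound is POSITIVE: the latter's escape clause
`casLB = 0` (no pole class at all) is closed inside `casoratian_bound_pal` by the non-vanishing of the Casoratian. -/
theorem cas_ge1a_pos1 (hb : InPolytope b) (hs : Sorted7 b) (hbj : InPolytope (shift b j)) (hj1 : 1 ≤ j) (hj7 : j ≤ 7)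
    (hprime : p.Prime) (hp5 : 5 ≤ p) (hwin : (b 0 + 2 : ℤ) < (p : ℤ) ^ 2) (hP : (p : ℤ) ≤ b 7) (hQ : b 0 < (p : ℤ) + b 5 + b 6) (hQ57 : b 0 < (p : ℤ) + b 5 + b 7) (hQ67 : (p : ℤ) + b 6 + b 7 ≤ b 0)
    (hF1 : b 1 < 2 * (p : ℤ)) (hF2 : b 0 < 2 * (p : ℤ) + b 6 + b 7) (hpd : (p : ℤ) ≤ dOf b) (hcas : casoratian b j ≠ 0) : (1 : ℤ) ≤ padicValRat p (casoratian b j) := by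
  haveI : Fact p.Prime := ⟨hprime⟩
  have hp2 : p % 2 = 1 := Nat.odd_iff.1 (hprime.odd_of_ne_two (by omega))
  obtain ⟨h21, h32, h43, h54, h65, h76⟩ := sorted7_chain hs
  obtain ⟨h0, hb1, hb2, hb3, hb4, hb5, hb6, hb7, hc1⟩ := box hb
  have hpb : (p : ℤ) ≤ b 0 := by linarith
  rcases Int.emod_two_eq_zero_or_one (b 0) with hr | hr
  · exact cover_LBP_j hb hj1 hj7 hbj hprime hp5 hpb hwin (cover1a_ev hb hs hP hQ hQ57 hQ67 hF1 hF2 hp5 hp2 hr) (v := 0) (B₀ := -20) (r := 1)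
      (by rw [oddFlag_false hr]; decide) (by norm_num) (by rw [oddFlag_false hr]; decide) (fun h => absurd hpd (not_le.2 h)) hcas
  · exact cover_LBP_j hb hj1 hj7 hbj hprime hp5 hpb hwin (cover1a_od hb hs hP hQ hQ57 hQ67 hF1 hF2 hp5 hp2 hr) (v := 0) (B₀ := -20) (r := 1)
      (by rw [oddFlag_true hr]; decide) (by norm_num) (by rw [oddFlag_true hr]; decide) (fun h => absurd hpd (not_le.2 h)) hcas

/-- On this profile `d(b) < 2p`. -/
theorem d_lt_two1a (hs : Sorted7 b) (hP : (p : ℤ) ≤ b 7) (_hQ : b 0 < (p : ℤ) + b 5 + b 6) (_hQ57 : b 0 < (p : ℤ) + b 5 + b 7) (_hQ67 : (p : ℤ) + b 6 + b 7 ≤ b 0) : dOf b < 2 * (p : ℤ) := by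
  obtain ⟨h21, h32, h43, h54, h65, h76⟩ := sorted7_chain hs
  rw [DecompositionWholeCone.dOf_expand]; linarith

/-- **`PathAccountingFirstPeriod`'s conclusion on this `N_p = 1` profile (short blocks `every (i,k) except (6,7)`), EVERY sorted `b`, every direction `j`, every depth**
(`C⋆ ≤ 6`; `d < 2p`; the node asks `0` at `⌊d/p⌋ = 0` and `1` at `⌊d/p⌋ = 1`). -/
theorem pathAccounting_profile1a (b : ℕ → ℤ) (j p : ℕ) (hb : InPolytope b) (hs : Sorted7 b) (hbj : InPolytope (shift b j))
    (hj1 : 1 ≤ j) (hj7 : j ≤ 7) (hprime : p.Prime) (hp5 : 5 ≤ p) (hwin : (b 0 + 2 : ℤ) < (p : ℤ) ^ 2) (hfp : FirstPeriod b p)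
    (hP : (p : ℤ) ≤ b 7) (hQ : b 0 < (p : ℤ) + b 5 + b 6) (hQ57 : b 0 < (p : ℤ) + b 5 + b 7) (hQ67 : (p : ℤ) + b 6 + b 7 ≤ b 0)
    (hcas : casoratian b j ≠ 0) :
    dOf b / (p : ℤ) - pairFloors b p - min (if 2 ≤ dOf b / (p : ℤ) then (1 : ℤ) else 0) (5 - (cStar b p : ℤ))
      ≤ padicValRat p (casoratian b j) := by
  obtain ⟨hF1, hF2⟩ := fp_bounds hfp
  have hp0 : (0 : ℤ) < p := by exact_mod_cast hprime.pos
  rw [pairFloors_eq_1a hb hs hprime.pos hQ hQ57 hQ67 hfp]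
  have hC6 : (cStar b p : ℤ) ≤ 6 := by exact_mod_cast cStar_le_six_1a hs hQ hQ57
  have hfd : dOf b / (p : ℤ) < 2 := by rw [Int.ediv_lt_iff_lt_mul hp0]; linarith [d_lt_two1a hs hP hQ hQ57 hQ67]
  rw [if_neg (by omega)]
  have hmin : -1 ≤ min (0 : ℤ) (5 - (cStar b p : ℤ)) := le_min (by norm_num) (by linarith)
  by_cases h1 : (p : ℤ) ≤ dOf b
  · linarith [cas_ge1a_pos1 hb hs hbj hj1 hj7 hprime hp5 hwin hP hQ hQ57 hQ67 hF1 hF2 h1 hcas]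
  · push Not at h1
    obtain ⟨h21, h32, h43, h54, h65, h76⟩ := sorted7_chain hs
    have hsum := hb.2.2
    simp only [Finset.sum_range_succ, Finset.sum_range_zero, zero_add, Nat.reduceAdd] at hsum
    have hd0 : 0 ≤ dOf b := by rw [DecompositionWholeCone.dOf_expand]; linarith
    have hfd0 : dOf b / (p : ℤ) = 0 := Int.ediv_eq_zero_of_lt hd0 h1
    rw [hfd0]
    linarith [cas_ge1a_zero hb hs hbj hj1 hj7 hprime hp5 hwin hP hQ hQ57 hQ67 hF1 hF2 hcas]

/-- **THE NODE ON THIS `N_p = 1` PROFILE, EVERY SORTED `b`, EVERY DEPTH: `PathAccountingFirstPeriod` with its binders VERBATIM plus `p ≤ b₇` and the profile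
inequalities.** -/
theorem pathAccountingFirstPeriod_profile1a :
    ∀ (b : ℕ → ℤ) (p : ℕ), InPolytope b → Sorted7 b → InPolytope (shift b 7) →
      p.Prime → 5 ≤ p → (b 0 + 2 : ℤ) < (p : ℤ) ^ 2 → FirstPeriod b p →
      (p : ℤ) ≤ b 7 → b 0 < (p : ℤ) + b 5 + b 6 → b 0 < (p : ℤ) + b 5 + b 7 → (p : ℤ) + b 6 + b 7 ≤ b 0 → casoratian b 7 ≠ 0 →
        dOf b / (p : ℤ) - pairFloors b p - min (if 2 ≤ dOf b / (p : ℤ) then (1 : ℤ) else 0) (5 - (cStar b p : ℤ))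
          ≤ padicValRat p (casoratian b 7) :=
  fun b p hb hs hb7 hprime hp5 hwin hfp hP hQ hQ57 hQ67 hcas =>
    pathAccounting_profile1a b 7 p hb hs hb7 (by norm_num) (by norm_num) hprime hp5 hwin hfp hP hQ hQ57 hQ67 hcas

end P1A

end Summit.KontsevichZagierPeriods.Zeta5Search.FullProfile
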